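import Summits.KontsevichZagierPeriods.KontsevichZagierPeriods.Theorems.DihedralNormalForm.Negative.LoadBearing
import Literature.NumberTheory.Transcendental.KZSubcalculusInvariants
import Literature.NumberTheory.Transcendental.SemialgebraicMapsProofs

/-!
# `ResidualBeyondGenusZero` (stmt-KontsevichZagierPeriods-3917): negative side, III — the first-coordinate window invariant of the sub-calculus without change of variables

Landed copy of §7.1–7.3 and §7.5 of the crux work file `Cruxes/ResidualBeyondGenusZero/Disproof.lean`
(cdisprove seat, generation 1). An additive invariant of the sub-calculus generated by the
additivity moves (1a), (1b) and the Newton–Leibniz moves (3) — everything except rule (2) — that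
does NOT factor through the value:

* §7.1 `setIntegral_band_inter_eq`: Newton–Leibniz soundness localised to a measurable part of the base;
* §7.2 `windowEval : FormalRep →+ (MSet → ℝ)`, `[r] ↦ (A ↦ ∫_{r.domain ∩ {x₀ ∈ A}} f)` on measurable
  windows of the FIRST coordinate (zero in dimension `0`); killed by (1a), (1b)
  (`closure_add_le_ker_windowEval`, via `KZ.restrictedEval`);
* §7.3 `primSpan`, the subgroup generated by the window functionals `A ↦ ∫_{[a,b] ∩ A} ∂F` of
  densities with a `ℚ`-SEMIALGEBRAIC primitive `F` on a slab of `ℝ¹` — exactly the shadows of the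
  Newton–Leibniz moves `1 → 0` — and the quotient invariant `windowClass`; **rules (1a), (1b), (3)
  preserve it** (`relationsWithoutCoV_le_ker_windowClass`: in dimensions `≥ 2` the first
  coordinate is a base coordinate of every band, so (3) preserves `windowEval` itself);
* §7.5 `locallyPrimitive_of_mem_primSpan`: every element of `primSpan` is, off finitely many
  points, locally of the form `A ↦ ∫_{z₀ ∈ A} g` with `g = ∂F`, `F` `ℚ`-semialgebraic.

Used by `RuleTwoLoadBearing.lean`; reusable for the pending rule-(2) claim of `DihedralNormalForm`
(Negative/LoadBearing.lean §5). Sources: Kontsevich–Zagier 2001, §1.2; Ayoub 2015, Rem. 1.2. -/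

noncomputable section

open MeasureTheory Set
open Literature.NumberTheory.Transcendental

namespace Summit.KontsevichZagierPeriods.ResidualBeyondGenusZero.Negative

open Summit.KontsevichZagierPeriods.DihedralNormalForm.Negative (simplex IsGenusZero relationsWithoutCoV)

/-! ## §7.1 Newton–Leibniz soundness over a measurable part of the base

The analytic core of `KZ.eval_eq_zero_of_mem_newtonLeibnizRel_holds`, localised: for a
Newton–Leibniz move `[band, ∂F/∂t] − [τ, F(b) − F(a)]` and ANY measurable `S ⊆ ℝⁿ`, the integral of
the band integrand over the part of the band lying over `τ ∩ S` equals the integral of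
`F(b) − F(a)` over `τ ∩ S` (Fubini along the last coordinate + FTC on each fibre). -/

/-- Windowed Newton–Leibniz identity (the soundness computation over `τ ∩ S`). [folklore] -/
theorem setIntegral_band_inter_eq {n : ℕ} (r : KZ.IntegralRep (n + 1)) (r' : KZ.IntegralRep n)
    (a b : (Fin n → ℝ) → ℝ) (F : (Fin (n + 1) → ℝ) → ℝ)
    (hab : ∀ x ∈ r'.domain, a x ≤ b x)
    (hdom : r.domain = {z | (Fin.init z : Fin n → ℝ) ∈ r'.domain ∧ a (Fin.init z) ≤ z (Fin.last n) ∧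
      z (Fin.last n) ≤ b (Fin.init z)})
    (hcont : ∀ x ∈ r'.domain, ContinuousOn (fun t : ℝ => F (Fin.snoc x t)) (Icc (a x) (b x)))
    (hderiv : ∀ x ∈ r'.domain, ∀ t ∈ Ioo (a x) (b x),
      HasDerivAt (fun s : ℝ => F (Fin.snoc x s)) (r.integrand (Fin.snoc x t)) t)
    (hr' : ∀ x ∈ r'.domain, r'.integrand x = F (Fin.snoc x (b x)) - F (Fin.snoc x (a x)))
    {S : Set (Fin n → ℝ)} (hS : MeasurableSet S) :
    ∫ z in r.domain ∩ {z | (Fin.init z : Fin n → ℝ) ∈ S}, r.integrand z =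
      ∫ x in r'.domain ∩ S, r'.integrand x := by
  have hτm : MeasurableSet (r'.domain ∩ S) := (KZ.IntegralRep.measurableSet_domain_holds r').inter hS
  have hinitm : Measurable (fun z : Fin (n + 1) → ℝ => (Fin.init z : Fin n → ℝ)) :=
    measurable_pi_lambda _ fun i => measurable_pi_apply _
  have hbm : MeasurableSet (r.domain ∩ {z | (Fin.init z : Fin n → ℝ) ∈ S}) :=
    (KZ.IntegralRep.measurableSet_domain_holds r).inter (hinitm hS)
  -- split off the last coordinate
  set e : (Fin (n + 1) → ℝ) ≃ᵐ ℝ × (Fin n → ℝ) :=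
    MeasurableEquiv.piFinSuccAbove (fun _ => ℝ) (Fin.last n) with he_def
  have he : MeasurePreserving e volume volume :=
    volume_preserving_piFinSuccAbove (fun _ => ℝ) (Fin.last n)
  have he_symm : ∀ p : ℝ × (Fin n → ℝ), e.symm p = Fin.snoc p.2 p.1 := fun p => by
    simp [he_def, MeasurableEquiv.piFinSuccAbove, Fin.snocEquiv]
  -- membership in the windowed band, fibrewise
  have hmem : ∀ x t, Fin.snoc x t ∈ r.domain ∩ {z | (Fin.init z : Fin n → ℝ) ∈ S} ↔
      x ∈ r'.domain ∩ S ∧ t ∈ Icc (a x) (b x) := by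
    intro x t
    rw [hdom]
    simp only [mem_inter_iff, mem_setOf_eq, Fin.init_snoc, Fin.snoc_last, mem_Icc]
    tauto
  -- the integrand extended by zero off the windowed band, and its fibres
  set G : (Fin (n + 1) → ℝ) → ℝ := (r.domain ∩ {z | (Fin.init z : Fin n → ℝ) ∈ S}).indicator
    r.integrand with hG_def
  have hG : Integrable G :=
    (integrable_indicator_iff hbm).mpr (r.integrableOn.mono_set inter_subset_left)
  have hfib_in : ∀ x ∈ r'.domain ∩ S, (fun t => G (Fin.snoc x t)) =
      (Icc (a x) (b x)).indicator (fun t => r.integrand (Fin.snoc x t)) := by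
    intro x hx
    ext t
    by_cases ht : t ∈ Icc (a x) (b x)
    · rw [Set.indicator_of_mem ht, hG_def, Set.indicator_of_mem ((hmem x t).2 ⟨hx, ht⟩)]
    · rw [Set.indicator_of_notMem ht, hG_def,
        Set.indicator_of_notMem (fun h => ht ((hmem x t).1 h).2)]
  have hfib_out : ∀ x ∉ r'.domain ∩ S, (fun t => G (Fin.snoc x t)) = fun _ => 0 := by
    intro x hx
    ext t
    rw [hG_def, Set.indicator_of_notMem (fun h => hx ((hmem x t).1 h).1)]
  have hG2 : Integrable (fun p : ℝ × (Fin n → ℝ) => G (Fin.snoc p.2 p.1))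
      ((volume : Measure ℝ).prod (volume : Measure (Fin n → ℝ))) := by
    have h := ((he.symm e).integrable_comp_emb e.symm.measurableEmbedding (g := G)).mpr hG
    rw [← Measure.volume_eq_prod]
    convert h using 1
    ext p
    simp [he_symm]
  calc ∫ z in r.domain ∩ {z | (Fin.init z : Fin n → ℝ) ∈ S}, r.integrand z
      = ∫ z, G z := (integral_indicator hbm).symm
    _ = ∫ p, G (e.symm p) := ((he.symm e).integral_comp' G).symm
    _ = ∫ p : ℝ × (Fin n → ℝ), G (Fin.snoc p.2 p.1) ∂(volume.prod volume) := by
        simp_rw [he_symm, Measure.volume_eq_prod]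
    _ = ∫ x, ∫ t, G (Fin.snoc x t) := integral_prod_symm _ hG2
    _ = ∫ x, (r'.domain ∩ S).indicator
          (fun x => F (Fin.snoc x (b x)) - F (Fin.snoc x (a x))) x := by
        apply integral_congr_ae
        filter_upwards [hG2.prod_left_ae] with x hx
        by_cases hxτ : x ∈ r'.domain ∩ S
        · rw [Set.indicator_of_mem hxτ, hfib_in x hxτ, integral_indicator measurableSet_Icc,
            integral_Icc_eq_integral_Ioc, ← intervalIntegral.integral_of_le (hab x hxτ.1)]
          apply intervalIntegral.integral_eq_sub_of_hasDerivAt_of_le (hab x hxτ.1) (hcont x hxτ.1)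
            (hderiv x hxτ.1)
          rw [intervalIntegrable_iff_integrableOn_Icc_of_le (hab x hxτ.1)]
          have hx' : Integrable (fun t => G (Fin.snoc x t)) := hx
          rw [hfib_in x hxτ] at hx'
          exact (integrable_indicator_iff measurableSet_Icc).mp hx'
        · rw [Set.indicator_of_notMem hxτ]
          rw [hfib_out x hxτ, integral_zero]
    _ = ∫ x in r'.domain ∩ S, (F (Fin.snoc x (b x)) - F (Fin.snoc x (a x))) :=
        integral_indicator hτm
    _ = ∫ x in r'.domain ∩ S, r'.integrand x :=
        (setIntegral_congr_fun hτm fun x hx => hr' x hx.1).symm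

/-! ## §7.2 The first-coordinate window evaluation -/

/-- The window "first coordinate in `A`" in each dimension (empty in dimension `0`). -/
def firstWindow (A : Set ℝ) : (n : ℕ) → Set (Fin n → ℝ)
  | 0 => ∅
  | (_ + 1) => {x | x 0 ∈ A}

/-- No window in dimension `0`. -/
@[simp] theorem firstWindow_zero (A : Set ℝ) : firstWindow A 0 = ∅ := rfl
/-- The window in positive dimension. -/
@[simp] theorem firstWindow_succ (A : Set ℝ) (m : ℕ) :
    firstWindow A (m + 1) = {x : Fin (m + 1) → ℝ | x 0 ∈ A} := rfl

/-- Windows over measurable sets are measurable. -/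
theorem measurableSet_firstWindow {A : Set ℝ} (hA : MeasurableSet A) :
    ∀ n, MeasurableSet (firstWindow A n)
  | 0 => MeasurableSet.empty
  | (_ + 1) => measurable_pi_apply 0 hA

/-- In dimension `m + 2` the first-coordinate window is the cylinder over the window in
dimension `m + 1` (the first coordinate is a base coordinate of every Newton–Leibniz band). -/
theorem firstWindow_succ_succ_eq (A : Set ℝ) (m : ℕ) :
    firstWindow A (m + 2) = {z : Fin (m + 2) → ℝ | (Fin.init z : Fin (m + 1) → ℝ) ∈ firstWindow A (m + 1)} := by
  ext z
  simp [firstWindow, Fin.init]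

/-- Measurable windows on the first coordinate axis. -/
abbrev MSet : Type := {A : Set ℝ // MeasurableSet A}

/-- The first-coordinate window evaluation: `[r] ↦ (A ↦ ∫_{r.domain ∩ {x₀ ∈ A}} f)` on measurable
windows `A ⊆ ℝ`, zero on dimension `0`. -/
def windowEval : KZ.FormalRep →+ (MSet → ℝ) :=
  FreeAbelianGroup.lift fun p => fun A => ∫ x in p.2.domain ∩ firstWindow A.1 p.1, p.2.integrand x

/-- `windowEval` on a generator. -/
theorem windowEval_of {n : ℕ} (r : KZ.IntegralRep n) (A : MSet) :
    windowEval (KZ.of r) A = ∫ x in r.domain ∩ firstWindow A.1 n, r.integrand x := by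
  simp [windowEval, KZ.of]

/-- `windowEval` at a fixed window is `KZ.restrictedEval` for the window family. -/
theorem windowEval_apply (c : KZ.FormalRep) (A : MSet) :
    windowEval c A = KZ.restrictedEval (firstWindow A.1) c := by
  induction c using FreeAbelianGroup.induction_on with
  | zero => simp
  | of p =>
    obtain ⟨n, r⟩ := p
    change windowEval (KZ.of r) A = KZ.restrictedEval (firstWindow A.1) (KZ.of r)
    rw [windowEval_of, KZ.restrictedEval_of]
  | neg p hp =>
    obtain ⟨n, r⟩ := p
    change windowEval (-KZ.of r) A = KZ.restrictedEval (firstWindow A.1) (-KZ.of r)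
    rw [map_neg, map_neg, Pi.neg_apply, windowEval_of, KZ.restrictedEval_of]
  | add x y hx hy => rw [map_add, map_add, Pi.add_apply, hx, hy]

/-- The additivity moves preserve every first-coordinate window evaluation. -/
theorem closure_add_le_ker_windowEval :
    AddSubgroup.closure (KZ.domainAddRel ∪ KZ.integrandAddRel) ≤ windowEval.ker := by
  intro c hc
  rw [AddMonoidHom.mem_ker]
  funext A
  rw [windowEval_apply, Pi.zero_apply]
  exact (AddMonoidHom.mem_ker).1
    (KZ.closure_add_le_ker_restrictedEval (firstWindow A.1) (measurableSet_firstWindow A.2) hc)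

/-! ## §7.3 The functionals with a semialgebraic primitive, and the quotient invariant -/

/-- The window functionals `A ↦ ∫_{[a,b] ∩ A} g` of densities `g` on a slab `[a, b] ⊂ ℝ¹` that
are derivatives of a `ℚ`-SEMIALGEBRAIC `F` (continuous on `[a,b]`): exactly the first-coordinate
shadows of the Newton–Leibniz moves from dimension `1` to dimension `0`. -/
def primFunctionals : Set (MSet → ℝ) :=
  {Λ | ∃ (a b : ℝ) (g F : (Fin 1 → ℝ) → ℝ), a ≤ b ∧
    IsSemialgebraicFunOn ℚ {z : Fin 1 → ℝ | z 0 ∈ Icc a b} F ∧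
    ContinuousOn (fun t : ℝ => F (fun _ => t)) (Icc a b) ∧
    (∀ t ∈ Ioo a b, HasDerivAt (fun s : ℝ => F (fun _ => s)) (g (fun _ => t)) t) ∧
    IntegrableOn g {z : Fin 1 → ℝ | z 0 ∈ Icc a b} ∧
    Λ = fun A => ∫ z in {z : Fin 1 → ℝ | z 0 ∈ Icc a b} ∩ {z | z 0 ∈ A.1}, g z}

/-- The subgroup generated by the primitive functionals. -/
def primSpan : AddSubgroup (MSet → ℝ) := AddSubgroup.closure primFunctionals

/-- **The invariant**: first-coordinate window evaluation modulo primitive functionals. -/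
def windowClass : KZ.FormalRep →+ (MSet → ℝ) ⧸ primSpan :=
  (QuotientAddGroup.mk' primSpan).comp windowEval

/-- The window class vanishes iff the window evaluation is a combination of primitive functionals. -/
theorem windowClass_eq_zero_iff (c : KZ.FormalRep) : windowClass c = 0 ↔ windowEval c ∈ primSpan := by
  simp [windowClass]

/-- `Fin.snoc` over the point `ℝ⁰` is the constant function. -/
theorem snoc_fin_zero (x : Fin 0 → ℝ) (t : ℝ) : (Fin.snoc x t : Fin 1 → ℝ) = fun _ => t := by
  funext i
  rw [Fin.fin_one_eq_zero i]
  exact Fin.snoc_last (α := fun _ => ℝ) (p := x) (x := t)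

/-- A Newton–Leibniz move from dimension `1` to dimension `0` has window evaluation in
`primFunctionals` (or zero). -/
theorem windowEval_mem_primSpan_of_nl_zero (r : KZ.IntegralRep 1) (r' : KZ.IntegralRep 0)
    (a b : (Fin 0 → ℝ) → ℝ) (F : (Fin 1 → ℝ) → ℝ)
    (hF : IsSemialgebraicFunOn ℚ r.domain F)
    (hab : ∀ x ∈ r'.domain, a x ≤ b x)
    (hdom : r.domain = {z | (Fin.init z : Fin 0 → ℝ) ∈ r'.domain ∧ a (Fin.init z) ≤ z (Fin.last 0) ∧
      z (Fin.last 0) ≤ b (Fin.init z)})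
    (hcont : ∀ x ∈ r'.domain, ContinuousOn (fun t : ℝ => F (Fin.snoc x t)) (Icc (a x) (b x)))
    (hderiv : ∀ x ∈ r'.domain, ∀ t ∈ Ioo (a x) (b x),
      HasDerivAt (fun s : ℝ => F (Fin.snoc x s)) (r.integrand (Fin.snoc x t)) t) :
    windowEval (KZ.of r - KZ.of r') ∈ primSpan := by
  have h0 : windowEval (KZ.of r') = 0 := by
    funext A; rw [windowEval_of]; simp
  rw [map_sub, h0, sub_zero]
  rcases r'.domain.eq_empty_or_nonempty with hemp | ⟨x₀, hx₀⟩
  · have hd : r.domain = ∅ := by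
      rw [hdom]; ext z; simp [hemp]
    have : windowEval (KZ.of r) = 0 := by
      funext A; rw [windowEval_of, hd]; simp
    rw [this]; exact zero_mem _
  · have hd : r.domain = {z : Fin 1 → ℝ | z 0 ∈ Icc (a x₀) (b x₀)} := by
      rw [hdom]; ext z
      have hi : (Fin.init z : Fin 0 → ℝ) = x₀ := Subsingleton.elim _ _
      simp only [mem_setOf_eq, hi, mem_Icc, Fin.last_zero]
      exact ⟨fun h => h.2, fun h => ⟨hx₀, h⟩⟩
    refine AddSubgroup.subset_closure ⟨a x₀, b x₀, r.integrand, F, hab x₀ hx₀, hd ▸ hF, ?_, ?_,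
      hd ▸ r.integrableOn, ?_⟩
    · simpa [snoc_fin_zero] using hcont x₀ hx₀
    · simpa [snoc_fin_zero] using hderiv x₀ hx₀
    · funext A
      rw [windowEval_of, hd]
      rfl

/-- **Rules (1a), (1b), (3) preserve the window class.** -/
theorem relationsWithoutCoV_le_ker_windowClass : relationsWithoutCoV ≤ windowClass.ker := by
  refine (AddSubgroup.closure_le _).mpr ?_
  rintro c (hc | hc)
  · -- additivity moves: window evaluation itself vanishes
    rw [SetLike.mem_coe, AddMonoidHom.mem_ker, windowClass_eq_zero_iff]
    have : windowEval c = 0 :=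
      (AddMonoidHom.mem_ker).1 (closure_add_le_ker_windowEval (AddSubgroup.subset_closure hc))
    rw [this]; exact zero_mem _
  · rw [SetLike.mem_coe, AddMonoidHom.mem_ker, windowClass_eq_zero_iff]
    obtain ⟨n, r, r', a, b, F, hF, -, -, hab, hdom, hcont, hderiv, hr', rfl⟩ := hc
    cases n with
    | zero => exact windowEval_mem_primSpan_of_nl_zero r r' a b F hF hab hdom hcont hderiv
    | succ m =>
      -- the first coordinate is a base coordinate: the windowed soundness identity
      have : windowEval (KZ.of r - KZ.of r') = 0 := by
        funext A
        rw [map_sub, Pi.sub_apply, Pi.zero_apply, windowEval_of, windowEval_of, sub_eq_zero,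
          firstWindow_succ_succ_eq]
        exact setIntegral_band_inter_eq r r' a b F hab hdom hcont hderiv hr'
          (measurableSet_firstWindow A.2 (m + 1))
      rw [this]; exact zero_mem _

/-! ## §7.5 Elements of `primSpan` have local semialgebraic primitives off finitely many points -/

/-- The rational slab `{z | z₀ ∈ [α, β]} ⊂ ℝ¹` is `ℚ`-semialgebraic. -/
theorem isSemialgebraic_slab (α β : ℚ) :
    Literature.ModelTheory.ExponentialFields.IsSemialgebraic ℚ {z : Fin 1 → ℝ | z 0 ∈ Icc (α : ℝ) β} := by
  have h1 : Literature.ModelTheory.ExponentialFields.IsSemialgebraic ℚ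
      {z : Fin 1 → ℝ | 0 < MvPolynomial.aeval z (MvPolynomial.X 0 - MvPolynomial.C α : MvPolynomial (Fin 1) ℚ)} :=
    Literature.ModelTheory.ExponentialFields.isSemialgebraic_setOf_eval_pos (k := ℚ) _
  have h2 : Literature.ModelTheory.ExponentialFields.IsSemialgebraic ℚ
      {z : Fin 1 → ℝ | 0 < MvPolynomial.aeval z (MvPolynomial.C β - MvPolynomial.X 0 : MvPolynomial (Fin 1) ℚ)} :=
    Literature.ModelTheory.ExponentialFields.isSemialgebraic_setOf_eval_pos (k := ℚ) _
  have h1' : Literature.ModelTheory.ExponentialFields.IsSemialgebraic ℚ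
      {z : Fin 1 → ℝ | MvPolynomial.aeval z (MvPolynomial.X 0 - MvPolynomial.C α : MvPolynomial (Fin 1) ℚ) = 0} :=
    Literature.ModelTheory.ExponentialFields.isSemialgebraic_setOf_eval_eq_zero (k := ℚ) _
  have h2' : Literature.ModelTheory.ExponentialFields.IsSemialgebraic ℚ
      {z : Fin 1 → ℝ | MvPolynomial.aeval z (MvPolynomial.C β - MvPolynomial.X 0 : MvPolynomial (Fin 1) ℚ) = 0} :=
    Literature.ModelTheory.ExponentialFields.isSemialgebraic_setOf_eval_eq_zero (k := ℚ) _
  convert (h2.union h2').inter (h1.union h1') using 1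
  ext z
  simp only [mem_setOf_eq, mem_Icc, mem_inter_iff, mem_union, map_sub, MvPolynomial.aeval_C,
    MvPolynomial.aeval_X, eq_ratCast, sub_pos, sub_eq_zero]
  constructor
  · rintro ⟨ha, hb⟩
    exact ⟨hb.lt_or_eq.imp id Eq.symm, ha.lt_or_eq.imp id Eq.symm⟩
  · rintro ⟨hb, ha⟩
    exact ⟨ha.elim le_of_lt ge_of_eq, hb.elim le_of_lt ge_of_eq⟩

/-- Local primitive data for a window functional on the rational slab `[α, β]`: a `ℚ`-semialgebraic
`F` with derivative `g` inside, `g` integrable, and `Λ(A) = ∫_{z₀ ∈ A} g` for measurable `A ⊆ [α, β]`. -/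
def HasLocalPrimitive (Λ : MSet → ℝ) (α β : ℚ) : Prop :=
  ∃ (g F : (Fin 1 → ℝ) → ℝ), IsSemialgebraicFunOn ℚ {z : Fin 1 → ℝ | z 0 ∈ Icc (α : ℝ) β} F ∧
    (∀ t ∈ Ioo (α : ℝ) β, HasDerivAt (fun s : ℝ => F (fun _ => s)) (g (fun _ => t)) t) ∧
    IntegrableOn g {z : Fin 1 → ℝ | z 0 ∈ Icc (α : ℝ) β} ∧
    ∀ A : MSet, A.1 ⊆ Icc (α : ℝ) β → Λ A = ∫ z in {z : Fin 1 → ℝ | z 0 ∈ A.1}, g z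

/-- Off a finite set of "endpoints", `Λ` has local primitives on every rational closed interval. -/
def LocallyPrimitive (Λ : MSet → ℝ) : Prop :=
  ∃ E : Finset ℝ, ∀ α β : ℚ, (α : ℝ) < β → Disjoint (Icc (α : ℝ) β) (E : Set ℝ) → HasLocalPrimitive Λ α β

/-- A functional vanishing on the subsets of `[α, β]` has local primitives there (`g = F = 0`). -/
theorem hasLocalPrimitive_zero (α β : ℚ) {Λ : MSet → ℝ}
    (hΛ : ∀ A : MSet, A.1 ⊆ Icc (α : ℝ) β → Λ A = 0) : HasLocalPrimitive Λ α β := by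
  refine ⟨0, 0, (isSemialgebraicFunOn_aeval (isSemialgebraic_slab α β) 0).congr fun x _ => by simp,
    fun t _ => by simpa using hasDerivAt_const t (0 : ℝ), integrableOn_zero, fun A hA => ?_⟩
  rw [hΛ A hA]
  simp

/-- Local primitives add. -/
theorem HasLocalPrimitive.add {Λ₁ Λ₂ : MSet → ℝ} {α β : ℚ} (h₁ : HasLocalPrimitive Λ₁ α β)
    (h₂ : HasLocalPrimitive Λ₂ α β) : HasLocalPrimitive (Λ₁ + Λ₂) α β := by
  obtain ⟨g₁, F₁, hF₁, hd₁, hi₁, hΛ₁⟩ := h₁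
  obtain ⟨g₂, F₂, hF₂, hd₂, hi₂, hΛ₂⟩ := h₂
  refine ⟨g₁ + g₂, F₁ + F₂, IsSemialgebraicFunOn.add_holds hF₁ hF₂,
    fun t ht => (hd₁ t ht).add (hd₂ t ht), hi₁.add hi₂, fun A hA => ?_⟩
  have hsub : {z : Fin 1 → ℝ | z 0 ∈ A.1} ⊆ {z : Fin 1 → ℝ | z 0 ∈ Icc (α : ℝ) β} := fun z hz => hA hz
  rw [Pi.add_apply, hΛ₁ A hA, hΛ₂ A hA, ← integral_add (hi₁.mono_set hsub) (hi₂.mono_set hsub)]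
  rfl

/-- Local primitives negate. -/
theorem HasLocalPrimitive.neg {Λ : MSet → ℝ} {α β : ℚ} (h : HasLocalPrimitive Λ α β) :
    HasLocalPrimitive (-Λ) α β := by
  obtain ⟨g, F, hF, hd, hi, hΛ⟩ := h
  refine ⟨-g, -F, hF.neg, fun t ht => (hd t ht).neg, hi.neg, fun A hA => ?_⟩
  rw [Pi.neg_apply, hΛ A hA, ← integral_neg]
  rfl

/-- A primitive functional has local primitives off its two endpoints. -/
theorem locallyPrimitive_of_mem_primFunctionals {Λ : MSet → ℝ} (h : Λ ∈ primFunctionals) :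
    LocallyPrimitive Λ := by
  obtain ⟨a, b, g, F, hab, hF, -, hd, hi, rfl⟩ := h
  refine ⟨{a, b}, fun α β hαβ hdisj => ?_⟩
  have ha : a ∉ Icc (α : ℝ) β := fun h => hdisj.le_bot ⟨h, by simp⟩
  have hb : b ∉ Icc (α : ℝ) β := fun h => hdisj.le_bot ⟨h, by simp⟩
  simp only [mem_Icc, not_and, not_le] at ha hb
  by_cases hcase : a < α ∧ (β : ℝ) < b
  · -- the interval lies inside `(a, b)`: restrict the data
    have hsub : {z : Fin 1 → ℝ | z 0 ∈ Icc (α : ℝ) β} ⊆ {z : Fin 1 → ℝ | z 0 ∈ Icc a b} :=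
      fun z hz => ⟨hcase.1.le.trans hz.1, hz.2.trans hcase.2.le⟩
    refine ⟨g, F, hF.mono hsub (isSemialgebraic_slab α β),
      fun t ht => hd t ⟨hcase.1.trans ht.1, ht.2.trans hcase.2⟩, hi.mono_set hsub, fun A hA => ?_⟩
    have : {z : Fin 1 → ℝ | z 0 ∈ Icc a b} ∩ {z | z 0 ∈ A.1} = {z : Fin 1 → ℝ | z 0 ∈ A.1} := by
      ext z
      simp only [mem_inter_iff, mem_setOf_eq, and_iff_right_iff_imp]
      exact fun hz => hsub (hA hz)
    simp only [this]
  · -- the interval misses `[a, b]`: the functional vanishes on its subsets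
    refine hasLocalPrimitive_zero α β fun A hA => ?_
    have hempty : {z : Fin 1 → ℝ | z 0 ∈ Icc a b} ∩ {z | z 0 ∈ A.1} = ∅ := by
      ext z
      simp only [mem_inter_iff, mem_setOf_eq, mem_Icc, mem_empty_iff_false, iff_false, not_and]
      intro hz hzA
      have hzI := hA hzA
      rw [not_and_or] at hcase
      rcases hcase with h | h
      · have : (β : ℝ) < a := ha (not_lt.1 h)
        linarith [hz.1, hzI.2]
      · have hb' : (β : ℝ) < b ∨ b < α := by
          by_cases h' : (α : ℝ) ≤ b
          · exact Or.inl (hb h')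
          · exact Or.inr (not_le.1 h')
        rcases hb' with h' | h'
        · exact h h'
        · linarith [hz.2, hzI.1]
    simp only [hempty, Measure.restrict_empty, integral_zero_measure]

/-- **Every element of `primSpan` is locally primitive.** -/
theorem locallyPrimitive_of_mem_primSpan {Λ : MSet → ℝ} (h : Λ ∈ primSpan) : LocallyPrimitive Λ := by
  induction h using AddSubgroup.closure_induction with
  | mem x hx => exact locallyPrimitive_of_mem_primFunctionals hx
  | zero => exact ⟨∅, fun α β _ _ => hasLocalPrimitive_zero α β fun A _ => rfl⟩
  | add x y _ _ hx hy =>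
    obtain ⟨E₁, h₁⟩ := hx
    obtain ⟨E₂, h₂⟩ := hy
    refine ⟨E₁ ∪ E₂, fun α β hαβ hdisj => ?_⟩
    rw [Finset.coe_union, disjoint_union_right] at hdisj
    exact (h₁ α β hαβ hdisj.1).add (h₂ α β hαβ hdisj.2)
  | neg x _ hx =>
    obtain ⟨E, hE⟩ := hx
    exact ⟨E, fun α β hαβ hdisj => (hE α β hαβ hdisj).neg⟩

end Summit.KontsevichZagierPeriods.ResidualBeyondGenusZero.Negative
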